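import Literature.Topology.FourManifolds.SphereSurgeryHandleParallel
import Literature.Topology.FourManifolds.SphereProductMiddleHomology
import HarnessLib

/-!
# The punctured tube `Sᵏ × (Bᵏ⁺¹ ∖ 0)` in the middle dimension `k = l`: generators of `H_k`, and
# the images of the meridian and the parallel in the tube and in the handle

Topic `Literature/Topology/FourManifolds`; first brick towards Kervaire–Milnor's **Lemma 5.6**
(*Groups of homotopy spheres I*, Ann. of Math. (2) 77 (1963), pp. 514–516) for the tree's surgery
along a framed sphere in the case `k = l` (`FramedSphereFamily … k (k + 1)`: core `Sᵏ`, fibre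
`ℝᵏ⁺¹`, in a `(2k+1)`-manifold). The punctured unit tube `Sᵏ × (Bˡ⁺¹ ∖ 0)`
(`FramedSphereFamily.puncturedUnitTube k l`), its radial homotopy equivalence with `Sᵏ × Sˡ`
(`FramedSphereFamily.tubeRetraction`), its meridian `meridianPT u₀ : v ↦ (u₀, v/2)` and parallel
`parallelPT : u ↦ (u, v₀)`, and Milnor's identification `glueMapPT : (u, w) ↦ (‖w‖ u, w/‖w‖)` with
the handle `ι × OD^{k+1} × Sˡ`, the unit tube `unitTube k l = Sᵏ × Bˡ⁺¹` with `inclPT`,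
`fstUnitTube` are the tree's (`SphereSurgeryHandleMeridian.lean`, `SphereSurgeryHandleParallel.lean`,
which treat `k ≠ l`: there one of the two classes generates the relevant homology group by itself). For
`k = l ≥ 2` both classes are needed — Kervaire–Milnor's `ε` (parallel) and `ε'` (meridian),
p. 516 — and this file PROVES, for singular homology with `ℤ` coefficients:

* `FramedSphereFamily.exists_eq_zsmul_meridianPT_add_zsmul_parallelPT` — **`H_k` of the punctured
  tube `Sᵏ × (Bᵏ⁺¹ ∖ 0)` is generated by the meridian and the parallel classes** (`k ≥ 2`; radial
  retraction onto `Sᵏ × Sᵏ` and the tree's Künneth-free slice isomorphism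
  `isIso_biprodDesc_slices_middle`, Hatcher Example 3.11), for any generator `θ` of `H_k(Sᵏ; ℤ)`
  (`eq_zero_of_zsmul_generator_eq_zero`: such a `θ` has infinite order);
* the entries of Kervaire–Milnor's diagram (p. 515) that do not involve the ambient manifold: in
  the tube `Sᵏ × Bᵏ⁺¹` the meridian dies (`map_inclPT_comp_meridianPT`, it bounds a fibre disc) and
  the parallel is a homology isomorphism (`isIso_map_inclPT_comp_parallelPT`: it projects to the
  identity of the core, the tube deformation retracting onto its core, `unitTubeEquiv`,
  `isIso_map_fstUnitTube`); in the handle `ι × OD^{k+1} × Sᵏ`,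
  through `glueMapPT`, the meridian is a homology isomorphism (`isIso_map_glueMapPT_comp_meridianPT`:
  it projects to the identity of the core sphere) and the parallel dies
  (`map_glueMapPT_comp_parallelPT`, it contracts onto the centre of the disc; Kosinski X.1
  Prop. (1.1)).

The Mayer–Vietoris sequences themselves are assembled in the sequel (`SphereCoreMeridian.lean`,
`SphereSurgeryMiddleHomology.lean`). Everything is proved; the only definitions (with bodies) are the
zero section `zeroSection` of the tube and its deformation retraction `unitTubeEquiv` onto the core.

## References

* M. Kervaire, J. Milnor, *Groups of homotopy spheres I*, Ann. of Math. (2) 77 (1963), Lemma 5.6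
  and its proof (pp. 514–516). doi:10.2307/1970128 [KervaireMilnorAnnals1963]
* J. Milnor, *Lectures on the h-cobordism theorem* (1965), Def. 3.11. [MilnorHCobordism1965]
* A. Kosinski, *Differential Manifolds* (1993), Ch. X §1, Prop. (1.1). [Kosinski1993]
* A. Hatcher, *Algebraic Topology*, CUP (2002), Cor. 2.11, Cor. 2.14, Example 3.11 / Thm. 3B.6.
  [HatcherAT2002]
-/

noncomputable section

open scoped Topology unitInterval
open Set Function Metric CategoryTheory CategoryTheory.Limits AddSubgroup
open Literature.AlgebraicTopology.SingularHomology

namespace Literature.Topology.FourManifolds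

/-- Local notation: `𝔼 n` is the model Euclidean space `EuclideanSpace ℝ (Fin n)`. -/
local notation "𝔼 " n:arg => EuclideanSpace ℝ (Fin n)

/-- Local notation: `𝕊 n` is the unit sphere in `EuclideanSpace ℝ (Fin (n + 1))`. -/
local notation "𝕊 " n:arg => (Metric.sphere (0 : EuclideanSpace ℝ (Fin (n + 1))) 1)

namespace FramedSphereFamily

variable {k : ℕ}

/-! ### Generators of the middle homology of the punctured tube -/

/-- A generator `θ` of `H_k(Sᵏ; ℤ) ≅ ℤ` (`k ≥ 1`) has infinite order: `c • θ = 0` forces `c = 0`.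
[cite: HatcherAT2002, Cor. 2.14] -/
theorem eq_zero_of_zsmul_generator_eq_zero (hk : 1 ≤ k) {θ : singularHomology ℤ ℤ (𝕊 k) k}
    (hθ : zmultiples θ = ⊤) {c : ℤ} (hc : c • θ = 0) : c = 0 := by
  obtain ⟨e⟩ := nonempty_singularHomology_sphere_iso_holds ℤ ℤ (n := k) hk
  -- `e θ` generates `ULift ℤ`, so it is non-zero
  have hgen : ∀ y : ULift.{0} ℤ, ∃ n : ℤ, n • e.hom θ = y := by
    intro y
    obtain ⟨n, hn⟩ := mem_zmultiples_iff.1 (hθ.symm ▸ mem_top (e.inv y) : e.inv y ∈ zmultiples θ)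
    refine ⟨n, ?_⟩
    rw [← map_zsmul e.hom.hom, show e.hom.hom (n • θ) = e.hom (n • θ) from rfl, hn,
      ← ModuleCat.comp_apply, e.inv_hom_id, ModuleCat.id_apply]
  have hne : e.hom θ ≠ 0 := by
    intro h0
    obtain ⟨n, hn⟩ := hgen ⟨1⟩
    rw [h0, smul_zero] at hn
    exact absurd (congrArg ULift.down hn) (by simp)
  have h1 : c • e.hom θ = 0 := by
    rw [← map_zsmul e.hom.hom, show e.hom.hom (c • θ) = e.hom (c • θ) from rfl, hc, map_zero]
  have h2 : c * (e.hom θ).down = 0 := by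
    have := congrArg ULift.down h1
    simpa using this
  rcases mul_eq_zero.1 h2 with h | h
  · exact h
  · exact absurd (ULift.ext _ _ h) hne

/-- **The middle homology of the punctured tube `Sᵏ × (Bᵏ⁺¹ ∖ 0)` is generated by the meridian
and the parallel** (`k ≥ 2`): every class in `H_k` is `c₁ • m + c₂ • p` with `m`, `p` the images of
a generator `θ` of `H_k(Sᵏ)` under `meridianPT u₀` and `parallelPT`. Through the radial homotopy
equivalence with `Sᵏ × Sᵏ` (`tubeRetraction k k`) this is the slice isomorphism
`H_k(Sᵏ) ⊕ H_k(Sᵏ) ≅ H_k(Sᵏ × Sᵏ)` (`isIso_biprodDesc_slices_middle`; Hatcher 2002, Example 3.11,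
here Künneth-free) — Kervaire–Milnor 1963, p. 516: `H_kM₀ ∋ ε, ε'`, the classes of the parallel and
the meridian of the torus `φ(Sᵏ × Sᵏ)`. [cite: KervaireMilnorAnnals1963, Lemma 5.6, proof (pp. 515–516)] [cite: HatcherAT2002, Thm. 3B.6 and Cor. 2.11] -/
theorem exists_eq_zsmul_meridianPT_add_zsmul_parallelPT (hk : 2 ≤ k)
    {θ : singularHomology ℤ ℤ (𝕊 k) k} (hθ : zmultiples θ = ⊤) (u₀ : 𝕊 k) {v₀ : 𝔼 (k + 1)}
    (hv₀ : v₀ ≠ 0) (hv₁ : ‖v₀‖ < 1) (z : singularHomology ℤ ℤ ↥(puncturedUnitTube k k) k) :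
    ∃ c₁ c₂ : ℤ, z = c₁ • singularHomology.map ℤ ℤ (meridianPT (k := k) (l := k) u₀) k θ +
      c₂ • singularHomology.map ℤ ℤ (parallelPT (k := k) hv₀ hv₁) k θ := by
  set E := singularHomology.isoOfHomotopyEquiv ℤ ℤ (tubeRetraction k k) k with hE
  -- the slice decomposition of `E z ∈ H_k(Sᵏ × Sᵏ)`
  haveI := isIso_biprodDesc_slices_middle hk u₀ (radialProjection (spherePt k) v₀)
  have hsurj : Function.Surjective (biprod.desc
      (singularHomology.map ℤ ℤ (⟨fun y => (u₀, y), by fun_prop⟩ : C(𝕊 k, (𝕊 k) × (𝕊 k))) k)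
      (singularHomology.map ℤ ℤ
        (⟨fun y => (y, radialProjection (spherePt k) v₀), by fun_prop⟩ : C(𝕊 k, (𝕊 k) × (𝕊 k)))
        k)) :=
    (ModuleCat.epi_iff_surjective _).1 inferInstance
  obtain ⟨a, ha⟩ := hsurj (E.hom z)
  rw [biprod_desc_apply] at ha
  obtain ⟨c₁, hc₁⟩ := mem_zmultiples_iff.1 (hθ.symm ▸ mem_top _ :
    (biprod.fst : singularHomology ℤ ℤ (𝕊 k) k ⊞ singularHomology ℤ ℤ (𝕊 k) k ⟶
      singularHomology ℤ ℤ (𝕊 k) k) a ∈ zmultiples θ)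
  obtain ⟨c₂, hc₂⟩ := mem_zmultiples_iff.1 (hθ.symm ▸ mem_top _ :
    (biprod.snd : singularHomology ℤ ℤ (𝕊 k) k ⊞ singularHomology ℤ ℤ (𝕊 k) k ⟶
      singularHomology ℤ ℤ (𝕊 k) k) a ∈ zmultiples θ)
  rw [← hc₁, ← hc₂] at ha
  -- the slices are the images of the meridian and the parallel
  have hm : singularHomology.map ℤ ℤ (⟨fun y => (u₀, y), by fun_prop⟩ : C(𝕊 k, (𝕊 k) × (𝕊 k))) k =
      singularHomology.map ℤ ℤ (meridianPT (k := k) (l := k) u₀) k ≫ E.hom := by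
    rw [hE, singularHomology.isoOfHomotopyEquiv_hom, tubeRetraction_toFun,
      ← singularHomology.map_comp, tubeRetractionFun_comp_meridianPT]
  have hp : singularHomology.map ℤ ℤ
      (⟨fun y => (y, radialProjection (spherePt k) v₀), by fun_prop⟩ : C(𝕊 k, (𝕊 k) × (𝕊 k))) k =
      singularHomology.map ℤ ℤ (parallelPT (k := k) hv₀ hv₁) k ≫ E.hom := by
    rw [hE, singularHomology.isoOfHomotopyEquiv_hom, tubeRetraction_toFun,
      ← singularHomology.map_comp, tubeRetractionFun_comp_parallelPT]
  rw [hm, hp, ModuleCat.comp_apply, ModuleCat.comp_apply] at ha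
  refine ⟨c₁, c₂, ?_⟩
  -- `E` is injective
  have hinj : Function.Injective E.hom := (ModuleCat.mono_iff_injective _).1 inferInstance
  apply hinj
  simp only [map_add, map_zsmul] at ha ⊢
  exact ha.symm

/-! ### The images of the meridian and the parallel in the tube and in the handle -/

/-- The core `(u, 0)` lies in the unit tube. [folklore] -/
theorem zero_mem_unitTube {l : ℕ} (u : 𝕊 k) :
    ((u, (0 : 𝔼 (l + 1))) : (𝕊 k) × (𝔼 (l + 1))) ∈ unitTube k l := by
  simp [unitTube]

/-- The zero section `u ↦ (u, 0)` of the unit tube `Sᵏ × Bˡ⁺¹` (its core). [folklore] -/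
def zeroSection (k l : ℕ) : C(𝕊 k, ↥(unitTube k l)) :=
  ⟨fun u => ⟨(u, 0), zero_mem_unitTube u⟩,
    (continuous_id.prodMk continuous_const).subtype_mk fun u => zero_mem_unitTube u⟩

/-- `fstUnitTube ∘ zeroSection = id`. [folklore] -/
theorem fstUnitTube_comp_zeroSection (k l : ℕ) :
    (fstUnitTube k l).comp (zeroSection k l) = ContinuousMap.id (𝕊 k) := by
  ext u : 1
  rfl

/-- **The unit tube `Sᵏ × Bˡ⁺¹` deformation retracts onto its core `Sᵏ`**: the projection
`fstUnitTube`, with homotopy inverse the zero section `u ↦ (u, 0)` and the straight-line homotopy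
`(t, (u, w)) ↦ (u, t w)` in the fibre (Hatcher 2002, Ch. 0). [cite: HatcherAT2002, Ch. 0 p. 4 and Cor. 2.11] -/
def unitTubeEquiv (k l : ℕ) : ContinuousMap.HomotopyEquiv ↥(unitTube k l) (𝕊 k) where
  toFun := fstUnitTube k l
  invFun := zeroSection k l
  left_inv := ⟨
    { toFun := fun p => ⟨(p.2.1.1, (p.1 : ℝ) • p.2.1.2), by
        show ‖(p.1 : ℝ) • p.2.1.2‖ < 1
        rw [norm_smul, Real.norm_of_nonneg p.1.2.1]
        calc (p.1 : ℝ) * ‖p.2.1.2‖ ≤ 1 * ‖p.2.1.2‖ := by gcongr; exact p.1.2.2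
          _ < 1 := by rw [one_mul]; exact p.2.2⟩
      continuous_toFun := by
        refine Continuous.subtype_mk ((continuous_fst.comp (continuous_subtype_val.comp
          continuous_snd)).prodMk ?_) _
        exact (continuous_subtype_val.comp continuous_fst).smul
          (continuous_snd.comp (continuous_subtype_val.comp continuous_snd))
      map_zero_left := fun q => by
        apply Subtype.ext
        show (q.1.1, (0 : ℝ) • q.1.2) = (q.1.1, 0)
        rw [zero_smul]
      map_one_left := fun q => by
        apply Subtype.ext
        show (q.1.1, (1 : ℝ) • q.1.2) = q.1
        rw [one_smul] }⟩
  right_inv := by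
    rw [fstUnitTube_comp_zeroSection]

/-- The forward map of `unitTubeEquiv` is the projection (definitional). [folklore] -/
@[simp] theorem unitTubeEquiv_toFun (k l : ℕ) : (unitTubeEquiv k l).toFun = fstUnitTube k l := rfl

/-- **The projection of the tube `Sᵏ × Bˡ⁺¹ → Sᵏ` is an isomorphism on homology** (the tube
deformation retracts onto its core; Hatcher 2002, Cor. 2.11). [cite: HatcherAT2002, Cor. 2.11] -/
theorem isIso_map_fstUnitTube (k l j : ℕ) : IsIso (singularHomology.map ℤ ℤ (fstUnitTube k l) j) := by
  rw [← unitTubeEquiv_toFun]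
  exact isIso_map_homotopyEquiv_toFun (unitTubeEquiv k l) j

/-- **In the tube the meridian bounds a fibre disc**: it is homotopic to a constant map, so its
class vanishes in `H_k`, `k ≠ 0` (Kervaire–Milnor 1963, proof of Lemma 5.6: `ε' ↦ 0` under
`H_kM₀ → H_kM`, the horizontal sequence). [cite: KervaireMilnorAnnals1963, Lemma 5.6, proof (p. 515)] -/
theorem map_inclPT_comp_meridianPT (hk : k ≠ 0) (u₀ : 𝕊 k) :
    singularHomology.map ℤ ℤ ((inclPT k k).comp (meridianPT (k := k) (l := k) u₀)) k = 0 := by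
  refine map_eq_zero_of_homotopic_const ℤ ℤ _ ⟨(u₀, 0), by simp [unitTube]⟩ ⟨?_⟩ hk
  exact
    { toFun := fun p => ⟨(u₀, ((1 - (p.1 : ℝ)) * 2⁻¹) • (p.2 : 𝔼 (k + 1))), by
        have h0 : 0 ≤ 1 - (p.1 : ℝ) := by have := p.1.2.2; linarith
        have h1 : 1 - (p.1 : ℝ) ≤ 1 := by have := p.1.2.1; linarith
        show ‖((1 - (p.1 : ℝ)) * 2⁻¹) • (p.2 : 𝔼 (k + 1))‖ < 1
        rw [norm_smul_coe_sphere (by positivity)]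
        linarith⟩
      continuous_toFun := by
        refine Continuous.subtype_mk (continuous_const.prodMk ?_) _
        fun_prop
      map_zero_left := fun v => by
        apply Subtype.ext
        refine Prod.ext rfl ?_
        simp [inclPT, meridianPT]
      map_one_left := fun v => by
        apply Subtype.ext
        refine Prod.ext rfl ?_
        simp }

/-- In the tube the parallel projects to the identity of the core (definitional). [folklore] -/
theorem fstUnitTube_comp_inclPT_comp_parallelPT {l : ℕ} {v₀ : 𝔼 (l + 1)} (hv₀ : v₀ ≠ 0)
    (hv₁ : ‖v₀‖ < 1) :
    (fstUnitTube k l).comp ((inclPT k l).comp (parallelPT (k := k) hv₀ hv₁)) =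
      ContinuousMap.id (𝕊 k) := by
  ext u : 1
  rfl

/-- **In the tube the parallel is a homology isomorphism** in every degree (Kervaire–Milnor 1963,
p. 516: `i(ε) = λ`, the parallel survives in the full tube `Sᵏ × Bˡ⁺¹ ≃ Sᵏ`; cf. the tree's
`mono_map_inclPT` for `k ≠ l`). [cite: KervaireMilnorAnnals1963, Lemma 5.6, proof (p. 516)] -/
theorem isIso_map_inclPT_comp_parallelPT {l : ℕ} {v₀ : 𝔼 (l + 1)} (hv₀ : v₀ ≠ 0)
    (hv₁ : ‖v₀‖ < 1) (j : ℕ) :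
    IsIso (singularHomology.map ℤ ℤ ((inclPT k l).comp (parallelPT (k := k) hv₀ hv₁)) j) := by
  haveI := isIso_map_fstUnitTube k l j
  haveI : IsIso (singularHomology.map ℤ ℤ ((inclPT k l).comp (parallelPT (k := k) hv₀ hv₁)) j ≫
      singularHomology.map ℤ ℤ (fstUnitTube k l) j) := by
    rw [← singularHomology.map_comp, fstUnitTube_comp_inclPT_comp_parallelPT,
      singularHomology.map_id]
    infer_instance
  exact IsIso.of_isIso_comp_right _ (singularHomology.map ℤ ℤ (fstUnitTube k l) j)

/-- **In the handle the meridian projects to the identity of the core sphere**: `pr ∘ glue ∘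
meridian = id` (`(u₀, v/2) ↦ (‖v/2‖ u₀, v)`; definitional up to `radialProjection (v/2) = v`).
[cite: KervaireMilnorAnnals1963, Lemma 5.6, proof (p. 516)] -/
theorem handleProj_comp_glueMapPT_comp_meridianPT (ι : Type) [Unique ι] (u₀ : 𝕊 k) :
    (handleProj ι k k).comp ((glueMapPT ι k k).comp (meridianPT (k := k) (l := k) u₀)) =
      ContinuousMap.id (𝕊 k) := by
  ext v : 1
  show radialProjection (spherePt k) ((2⁻¹ : ℝ) • (v : 𝔼 (k + 1))) = v
  exact radialProjection_smul _ (by norm_num) v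

/-- **In the handle the meridian is a homology isomorphism** in every degree: under Milnor's
identification `(u, w) ↦ (‖w‖ u, w/‖w‖)` the meridian of the torus becomes a slice `pt × Sᵏ` of the
handle `OD^{k+1} × Sᵏ`, which deformation retracts onto its core (Kervaire–Milnor 1963, p. 516:
"`ε' = ε'(1) ∈ H_kM₀` [is] the homology class corresponding to the meridian"; tree:
`isIso_map_handleProj`). [cite: KervaireMilnorAnnals1963, Lemma 5.6, proof (p. 516)] -/
theorem isIso_map_glueMapPT_comp_meridianPT (ι : Type) [Unique ι] (u₀ : 𝕊 k) (j : ℕ) :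
    IsIso (singularHomology.map ℤ ℤ ((glueMapPT ι k k).comp (meridianPT (k := k) (l := k) u₀)) j) := by
  haveI := isIso_map_handleProj (k := k) (l := k) ι j
  haveI : IsIso (singularHomology.map ℤ ℤ ((glueMapPT ι k k).comp (meridianPT (k := k) (l := k) u₀)) j ≫
      singularHomology.map ℤ ℤ (handleProj ι k k) j) := by
    rw [← singularHomology.map_comp, handleProj_comp_glueMapPT_comp_meridianPT,
      singularHomology.map_id]
    infer_instance
  exact IsIso.of_isIso_comp_right _ (singularHomology.map ℤ ℤ (handleProj ι k k) j)

/-- **In the handle the parallel dies**: under Milnor's identification the parallel `u ↦ (u, v₀)`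
becomes the sphere `{‖y‖ = ‖v₀‖} × pt` of the handle `OD^{k+1} × Sᵏ`, which contracts onto the
centre of the disc, so its class vanishes in `H_k`, `k ≠ 0` (Kosinski 1993, X.1 Prop. (1.1): the
class of the sphere is killed by the surgery; Kervaire–Milnor 1963, p. 516: `ε ↦ 0` under
`H_kM₀ → H_kM'`, the vertical sequence). [cite: Kosinski1993, Ch. X §1, Prop. 1.1] [cite: KervaireMilnorAnnals1963, Lemma 5.6, proof (p. 516)] -/
theorem map_glueMapPT_comp_parallelPT (ι : Type) [Unique ι] (hk : k ≠ 0) {v₀ : 𝔼 (k + 1)}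
    (hv₀ : v₀ ≠ 0) (hv₁ : ‖v₀‖ < 1) :
    singularHomology.map ℤ ℤ ((glueMapPT ι k k).comp (parallelPT (k := k) hv₀ hv₁)) k = 0 := by
  let b₀ : ↥(ballTimesSphere ι k k) := ⟨(DiscreteIndex.mk default,
    ((0 : 𝔼 (k + 1)), radialProjection (spherePt k) v₀)), by simp⟩
  refine map_eq_zero_of_homotopic_const ℤ ℤ _ b₀ ⟨?_⟩ hk
  exact
    { toFun := fun p => ⟨(DiscreteIndex.mk default,
        (((1 - (p.1 : ℝ)) * ‖v₀‖) • (p.2 : 𝔼 (k + 1)), radialProjection (spherePt k) v₀)), by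
          have h0 : 0 ≤ 1 - (p.1 : ℝ) := by have := p.1.2.2; linarith
          rw [mem_ballTimesSphere_iff, norm_smul_coe_sphere (mul_nonneg h0 (norm_nonneg _))]
          calc (1 - (p.1 : ℝ)) * ‖v₀‖ ≤ 1 * ‖v₀‖ := by gcongr; linarith [p.1.2.1]
            _ < 1 := by rw [one_mul]; exact hv₁⟩
      continuous_toFun := by
        refine Continuous.subtype_mk (continuous_const.prodMk (Continuous.prodMk ?_ continuous_const)) _
        fun_prop
      map_zero_left := fun u => by
        apply Subtype.ext
        simp [glueMapPT, parallelPT]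
      map_one_left := fun u => by
        apply Subtype.ext
        simp [b₀] }

end FramedSphereFamily

end Literature.Topology.FourManifolds

end
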